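import Literature.MathematicalPhysics.QuantumFieldTheory.Balaban1983to89.B9Thm313WholeLeafCompletePairMB
import Literature.MathematicalPhysics.QuantumFieldTheory.Balaban1983to89.B9Thm313WholeBlocksPairMBZ
import Literature.MathematicalPhysics.QuantumFieldTheory.Balaban1983to89.B9Thm313WholeLeafRelZ

/-!
# `Balaban1983to89.B9Thm313WholeLeafCompletePairMBZ` — [B9] Theorem 3.13 (p. 426) AS THE WHOLE PRINTED LEAF `B9.Thm313Printed`, residual ABSORBED on the
# direction-pair family with ε∕β-indexed constants (the knit's consumed row-21 leaf `…LeafCompletePairMB`), with the COARSE-FIELD LETTERS RE-CLASSED through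
# one free positive weight per member (R1-cls LEAF; repair of the cell's located «C-LETTER-FLAT-AT-ONE»)

T. Bałaban, *Propagators for lattice gauge theories in a background field*, Commun. Math. Phys. **99** (1985) 389–434
[`Balaban1985BackgroundPropagators`, "B9"]; [4] = T. Bałaban, *Propagators and renormalization transformations for lattice
gauge theories. II*, Commun. Math. Phys. **96** (1984) 223–250 [`Balaban1984PropagatorsII`].  statement-level skeleton of published
theorems with citation tags; proofs where landed; nothing here is a claim about the Yang–Mills mass gap.

WHY THIS FILE.  dag-n06-h located (bus 2026-08-27, `B9LettersHCOneObstruction`) that the displayed binder `hletters : … Letters313 …` of the row-21 leaf of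
record has NO inhabitant at the knit's flat pins for any value of its numeric binders: the (3.132)∕(3.126) letters `c1_2 ∕ c1_1 ∕ gQs2 ∕ gQs1` (and the
∇∕probe letters `dgQs ∕ dgQsd ∕ pQ ∕ pQd ∕ pXQs`) meet in the FLAT coarse classes, while at the instance (QG₁Q\*)⁻¹ alone carries L^{+jD} (only the
product G₀Q\*C is convention-free).  The repair of record (dag-n06-l R-WORD «R1-cls», def-Y WORD (W2), director-ym LINE №198): the coarse middle class
becomes the WEIGHTED sharp-block class `weightNorm (ofBlocks blkZ) (wZ i)` (undifferentiated side) ∕ `(len · wZ i)` (differentiated side) with ONE free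
positive weight per member, the knit pinning `wZ x := n⁻¹` (def-Y's block count).  This file is the consumed leaf re-issued over the re-classed letter
schemas (`B9Thm313WholeZ.Letters313Z`, `…LeftZ.Letters313DZ`, `…DirZ.Letters313DMZ`, `…HolderZ.Letters313HZ`, `B9Thm312WholeHZ.LettersHHZ`):
★ `thm313Printed_completePairMBZ` — conclusion `B9.Thm313Printed …`, pins and every other binder UNCHANGED; proof verbatim over the Z-chain
(`thm313Printed_of_stepRelZ`, `GG_l2Block_pairMZ`, `GG_holder_pairMBZ`).  `wZ i ≡ 1` recovers the predecessor definitionally.  The (3.46) block-L² coarse letters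
are re-classed TOO (`Letters313L2PZ ∕ Letters313L2MZ`, second free weight `vZ` per member, the knit pinning `vZ x := n^{−1∕2}`; bus «C-LETTER-L2-FLAT»),
so that NO letter of this leaf reads (QG₁Q\*)⁻¹, Q or a Q\*-word through a flat coarse class.

HONEST SCOPE.  Nothing of print is asserted: every analytic input is a HYPOTHESIS of printed ∕ md shape; kernel-checked bookkeeping.  NOT a node discharge,
NOT summit progress; one finite lattice at a time; nothing continuum, nothing about the mass gap.  Cell `pub-ymgap` (HUMAN RULING D-0062), Track A node
N06 [B9], N06-ASSIGNMENT v1 row 21 (bundle F7), seat `pub-ymgap-dag-n06-l` (g14), 2026-08-27.  NEW file; nothing landed is modified.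
-/

namespace Literature.MathematicalPhysics.QuantumFieldTheory.Balaban1983to89.B9Thm313WholeLeafCompletePairMBZ

open Literature.MathematicalPhysics.QuantumFieldTheory.Balaban1983to89
open Finset B6RandomWalk B6RandomWalkHom B9Thm34Ext B9Thm37GlueCor36 B11SectG B9SectDSup B9Thm37AllNorms
open B9Thm37AllNormsInstances B9FromB6 B9FromB6ModelSignsOn B9SectBStepWhole B9Thm312Whole B9Thm312WholeLeaf B9Thm312WholeLeft B9Thm313Whole
open B9Thm313WholeLeft B9Thm312WholeLeafLeftGlob B9Ineq347CoReading B9SectCDiffDict B9CoRealizesRel B9Thm37Glue B9SectDL2Decay B9RWSums343Holder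
open B9RWSumsReadsRel B9RWSumsReadsNbr B9Ineq347 B9Thm312WholeClasses B9Thm312WholeL2 B9Thm312WholeBlocksRel B9Thm312WholeBlocksNbr B9Thm313WholeLeafRel
open B9Thm312WholeHolder B9Thm312WholeHHolder B9Thm313WholeHolder B9Thm313WholeL2G B9Thm313WholeL2GP B9Thm313WholeInput B9Thm313WholeBlocksNbr B9Thm312WholeLeafAll
open B9RWSums346SecondDiff B9Thm313WholeBlocksNbrRec B9RWSums344InputFam B9Thm312WholeDir B9Thm312WholeBlocksPairM B9Thm313WholeDir B9Thm313WholeDirInput B9Thm313WholeBlocksPairM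
open B9Thm313WholeLeafCompletePairM B9Thm312WholeDirB B9Thm313WholeDirInputB B9Thm313WholeBlocksPairMB B9Thm313WholeLeafCompletePairMB B9Thm313WholeBlocksPairMZ B9Thm313WholeBlocksPairMBZ B9Thm313WholeLeafRelZ
open B9Thm312WholeHZ B9Thm313WholeZ B9Thm313WholeLeftZ B9Thm313WholeHolderZ B9Thm313WholeInputZ B9Thm313WholeDirZ B9Thm313WholeDirInputZ B9Thm313WholeDirInputBZ
open B9Thm313WholeL2GZ B9Thm313WholeL2GPZ B9Thm313WholeDirL2Z

noncomputable section

section Family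

variable {I : Type} {c35 : ℝ} {geo : I → B9.Geometry} {bg : I → B9.Backgrounds}
variable [∀ i, Fintype (geo i).Site] [∀ i, DecidableEq (geo i).Site]
variable {X Y Z W PX PY : I → Type} {P : Type} [∀ i, Fintype (X i)] [∀ i, DecidableEq (X i)] [∀ i, Fintype (Y i)]
  [∀ i, Fintype (Z i)] [∀ i, Fintype (W i)] [∀ i, Fintype (PX i)] [∀ i, Fintype (PY i)] [Fintype P]

/-- Arithmetic of *"for α₀ sufficiently small"*: t ≧ 0 and m ≦ (2(t + 1))⁻¹ give tm ≦ ½. [folklore] -/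
private theorem small_aux_mbz {t m : ℝ} (ht : 0 ≤ t) (hm : m ≤ (2 * (t + 1))⁻¹) : t * m ≤ 1 / 2 := by
  have hpos : 0 < 2 * (t + 1) := by linarith
  have h1 : t * m ≤ t * (2 * (t + 1))⁻¹ := mul_le_mul_of_nonneg_left hm ht
  have h2 : t * (2 * (t + 1))⁻¹ ≤ 1 / 2 := by
    rw [← div_eq_mul_inv, div_le_iff₀ hpos]
    linarith
  linarith

-- heartbeat budget (v1.1): the one-block proof below elaborates at ≈ 160–190k heartbeats on the farm and above the 200k default
-- under `lake build` (pre-emptive: same shape as the three sibling leaves that failed the lane build 2026-08-27); statement and proof byte-identical to v1.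
set_option maxHeartbeats 400000 in

/-- **Z-TWIN (R1-cls LEAF OF RECORD FOR ROW 21)** of `B9Thm313WholeLeafCompletePairMB.thm313Printed_completePairMB`: binders `(wZ : ∀ i, 𝔅ᵢ → ℝ)`
`(hwZ : ∀ i y, 0 < wZ i y)` inserted before `hletters`; `hletters ↦ Letters313Z … (wZ i) (hwZ i)`, `hlettersD ↦ Letters313DZ ∧ Letters313DMZ`, `hLHH ↦ LettersHHZ …
(weightNorm (ofBlocks blkZ) (wZ i) …)`, `hLH3 ↦ Letters313HZ … (hgeo i) (wZ i) (hwZ i) …`, and `(vZ : ∀ i, 𝔅ᵢ → ℝ) (hvZ : …)` before `hLL2 ↦ Letters313L2PZ ∧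
Letters313L2MZ … (vZ i) (hvZ i)`; conclusion, pins, constants and every other binder VERBATIM;
proof verbatim over `thm313Printed_of_stepRelZ`, `GG_l2Block_pairMZ`, `GG_holder_pairMBZ`. ★★ **THEOREM 3.13 AS THE WHOLE PRINTED LEAF `B9.Thm313Printed`, AT THE PINS, PAIR-M FACE, WITH THE β∕ε-INDEXED STEP SCHEMA AND INPUT LETTERS**
(p. 426; the twin of `B9Thm313WholeLeafCompletePairM.thm313Printed_completePairM`).  Inputs: those of the PairM leaf VERBATIM except `hstepD : … → StepDirB …
(θ_D·Mα₀) (fun β => θ_H β·Mα₀) (fun ε => θ_I ε·Mα₀) δ_K U` and `hLIM : … → Letters313IMB … Br (fun ε => θ_V ε·Mα₀) Bd Bd2 δ₃ δ_K U` with θ_H θ_I θ_V Br :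
ℝ → ℝ (non-negative on [0,1) resp. (0,∞)).  PROVED INSIDE: every member, as in the PairM leaf — the Hölder block by
`B9Thm313WholeBlocksPairMB.GG_holder_pairMB` with the uniformising letters t_H(β) = θ_H(β)a₁, t_I(ε) = θ_I(ε)a₁, t_V(ε) = θ_V(ε)a₁ and B_r(ε), so the output
families of `B9.Thm313Printed` are β∕ε-DEPENDENT exactly where print's B₀(β), B′₀(ε), B′₀(ε,β) are (Theorem 3.1 p. 397).  Nothing of print asserted
beyond the hypothesis schemas.
[cite: Balaban1985BackgroundPropagators, Thm 3.13 p.426 + Thm 3.12 p.423 + (3.39)–(3.47) pp.397–398 + (3.147)–(3.153) pp.425–426; Balaban1984PropagatorsII, (2.51)–(2.52) p.232 + Lemma 2.1 (2.60)–(2.61) p.234] -/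
theorem thm313Printed_completePairMBZ (𝔬 : ∀ i, Ops (geo i) (bg i) (X i) (Y i) (Z i) (W i)) (R₀ : I → ℝ) (H₀ : I → Prop)
    (GG : ∀ i, B9.KernelFamily (geo i) (bg i)) (bH : ∀ i, BlockNorm (toB6 (geo i) (R₀ i) (H₀ i)) (W i → ℝ))
    (𝔭 : ∀ i, HolderProbes (geo i) (bg i) (X i) (Y i) (PX i) (PY i))
    (bHX : ∀ i, ℝ → BlockNorm (toB6 (geo i) (R₀ i) (H₀ i)) (X i → ℝ))
    (Dd Dds : ∀ i, (bg i).Cfg → P → Module.End ℝ (X i → ℝ))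
    (bHW : ∀ i, ℝ → BlockNorm (toB6 (geo i) (R₀ i) (H₀ i)) (W i → ℝ))
    (ev : ∀ i, (geo i).Loc → X i → ℝ) (evY : ∀ i, (geo i).Loc → Y i → ℝ) {PL : ∀ i, (geo i).Loc → Prop}
    (Rel : ∀ i, (geo i).Site → (geo i).Site → Prop) [∀ i, DecidableRel (Rel i)] (m mN : ℕ)
    (r Cev CL θ₁ θD θ₂ r₁ B₀ B₂ B₄ δ₀ δK σ c ρ a₁ M₁ ML B₃ δ₃ ρ' α Lc κ₀ : ℝ) (Bh Bi Bq BhD Bx Bd θH θI θV Br : ℝ → ℝ)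
    (Bi2 Bd2 : ℝ → ℝ → ℝ)
    (hθ₁ : 0 ≤ θ₁) (hθD : 0 ≤ θD) (hθH : ∀ β, 0 ≤ β → β < 1 → 0 ≤ θH β) (hθI : ∀ ε, 0 < ε → 0 ≤ θI ε) (hθ₂ : 0 ≤ θ₂)
    (hθV : ∀ ε, 0 < ε → 0 ≤ θV ε) (hr₁ : 0 ≤ r₁) (hB₀ : 0 ≤ B₀) (hB₂ : 0 ≤ B₂)
    (hB₃ : 0 ≤ B₃) (hB₄ : 0 ≤ B₄) (hBr : ∀ ε, 0 < ε → 0 ≤ Br ε) (hσ : 0 ≤ σ) (hρ' : 0 < ρ') (hρ'ρ : ρ' + 3 * σ ≤ ρ) (hρ'ρ₅ : ρ' + 5 * σ ≤ ρ)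
    (hσρ' : 3 * σ < (1 - α) * ρ')
    (hρS : ρ ≤ δ₀) (hρ₃ : ρ ≤ δ₃) (hρδ : ρ + σ ≤ δK) (hc : 0 ≤ c) (ha₁ : 0 < a₁) (hM₁ : 0 < M₁)
    (hα0 : 0 ≤ α) (hBi : ∀ ε, 0 < ε → ε ≤ 1 → 0 ≤ Bi ε) (hBd : ∀ ε, 0 < ε → ε ≤ 1 → 0 ≤ Bd ε)
    (hBi2 : ∀ ε β, 0 < ε → ε ≤ 1 → 0 ≤ β → β < 1 → 0 ≤ Bi2 ε β) (hBd2 : ∀ ε β, 0 < ε → ε ≤ 1 → 0 ≤ β → β < 1 → 0 ≤ Bd2 ε β)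
    (hBh : ∀ β, 0 ≤ β → β < 1 → 0 ≤ Bh β) (hBq : ∀ β, 0 ≤ β → β < 1 → 0 ≤ Bq β) (hBhD : ∀ β, 0 ≤ β → β < 1 → 0 ≤ BhD β)
    (hBx : ∀ β, 0 ≤ β → β < 1 → 0 ≤ Bx β) (hCev : 0 ≤ Cev) (hCL1 : 1 ≤ CL)
    (hgeo : ∀ i, GeoOK (geo i)) (S : ∀ i, ModelSignsOn (geo i) (PL i))
    (hL1 : ∀ i, 1 ≤ (geo i).L) (hLle : ∀ i, (geo i).L ≤ Lc) (hη : ∀ i, 0 < (geo i).eta) (hκ : ∀ i, (bH i).κ ≤ κ₀)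
    (hκW : ∀ (i : I) (ε : ℝ), (bHW i ε).κ ≤ κ₀)
    (hrow : ∀ i, ML ≤ (geo i).M → RowSum (toB6 (geo i) (R₀ i) (H₀ i)) σ c)
    (hL21 : ∀ δ : ℝ, 0 < δ → ∃ ML' c' : ℝ, Lemma21AboveG geo R₀ H₀ δ α ML' c')
    (hnbr : ∀ (i : I) (y : (geo i).Site), (nbr (geo i) r y).card ≤ mN)
    (hCL : ∀ (i : I) (a a' : (geo i).Site), (geo i).dist a a' ≤ r → (geo i).len a ≤ CL * (geo i).len a')
    (hsat : ∀ (i : I) (n : Fin 4) (B' δ' : ℝ),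
      (∀ a a' b, Rel i a a' → maj342 (geo i) n B' δ' a b = maj342 (geo i) n B' δ' a' b) ∧
      (∀ a b b', Rel i b b' → maj342 (geo i) n B' δ' a b = maj342 (geo i) n B' δ' a b'))
    (hmult : ∀ (i : I) (y' : (geo i).Site), (Finset.univ.filter (fun y'' => Rel i y'' y')).card ≤ m)
    (hcoR : ∀ (i : I) (U : (bg i).Cfg),
      CoRealizesRel (GG i) 0 U (Rel i) (𝔬 i).blk (𝔬 i).blk (ev i) ((𝔬 i).GG U) ∧
      CoRealizesRel (GG i) 2 U (Rel i) (𝔬 i).blk (𝔬 i).blkY (evY i) ((𝔬 i).GG U ∘ₗ (𝔬 i).Dstar U))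
    (hco1R : ∀ (i : I) (U : (bg i).Cfg), CoRealizesRel (GG i) 1 U (Rel i) (𝔬 i).blkY (𝔬 i).blk (ev i) ((𝔬 i).D U ∘ₗ (𝔬 i).GG U))
    (hcoG : ∀ (i : I) (U : (bg i).Cfg),
      CoReadsGlob (GG i) 0 U (𝔬 i).blk (𝔬 i).blk (ev i) ((𝔬 i).GG U) ∧
      CoReadsGlob (GG i) 1 U (𝔬 i).blkY (𝔬 i).blk (ev i) ((𝔬 i).D U ∘ₗ (𝔬 i).GG U) ∧
      CoReadsGlob (GG i) 2 U (𝔬 i).blk (𝔬 i).blkY (evY i) ((𝔬 i).GG U ∘ₗ (𝔬 i).Dstar U))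
    (hsymGG : ∀ i, M₁ ≤ (geo i).M → ∀ α₀ : ℝ, 0 < α₀ → (geo i).M * α₀ ≤ a₁ →
      ∀ U : (bg i).Cfg, (bg i).Reg335 c35 α₀ U → (bg i).Reg336 c35 α₀ U →
        IsTransposePair ((𝔬 i).GG U) ((𝔬 i).GG U) ∧ IsTransposePair ((𝔬 i).D U ∘ₗ (𝔬 i).GG U) ((𝔬 i).GG U ∘ₗ (𝔬 i).Dstar U))
    (hl2N : ∀ (i : I) (U : (bg i).Cfg),
      L2ReadsNbr (R := R₀ i) (H := H₀ i) (GG i) 0 U (Rel i) r Cev (𝔬 i).blk (𝔬 i).blk (ev i) ((𝔬 i).GG U) ∧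
      L2ReadsNbr (R := R₀ i) (H := H₀ i) (GG i) 1 U (Rel i) r Cev (𝔬 i).blkY (𝔬 i).blk (ev i) ((𝔬 i).D U ∘ₗ (𝔬 i).GG U) ∧
      L2ReadsNbr (R := R₀ i) (H := H₀ i) (GG i) 2 U (Rel i) r Cev (𝔬 i).blk (𝔬 i).blkY (evY i) ((𝔬 i).GG U ∘ₗ (𝔬 i).Dstar U) ∧
      L2ReadsNbr (R := R₀ i) (H := H₀ i) (GG i) 3 U (Rel i) r Cev ((𝔬 i).blk ∘ Prod.fst) (𝔬 i).blk (ev i)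
        (familyOp (fun q : P × P => Dd i U q.1 ∘ₗ ((𝔬 i).GG U ∘ₗ Dds i U q.2))) ∧
      L2ReadsNbr (R := R₀ i) (H := H₀ i) (GG i) 4 U (Rel i) r Cev ((𝔬 i).blk ∘ Prod.fst) (𝔬 i).blk (ev i)
        (familyOp (fun q : P × P => (Dd i U q.1 ∘ₗ Dd i U q.2) ∘ₗ (𝔬 i).GG U)) ∧
      L2ReadsNbr (R := R₀ i) (H := H₀ i) (GG i) 5 U (Rel i) r Cev ((𝔬 i).blk ∘ Prod.fst) (𝔬 i).blk (ev i)
        (familyOp (fun q : P × P => (𝔬 i).GG U ∘ₗ (Dds i U q.1 ∘ₗ Dds i U q.2))))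
    (hH1N : ∀ (i : I) (U : (bg i).Cfg),
      H1ReadsNbr (GG i) U (𝔭 i) (Rel i) r (𝔬 i).blk (𝔬 i).blkY (ev i) (evY i) ((𝔬 i).D U ∘ₗ (𝔬 i).GG U)
        ((𝔬 i).GG U ∘ₗ (𝔬 i).Dstar U))
    (hIF : ∀ (i : I) (U : (bg i).Cfg),
      InputReadsFam (GG i) U (bHX i) r ((𝔬 i).blk ∘ Prod.fst) ((𝔭 i).blkPX ∘ Prod.fst) (fun β => sliceProbe ((𝔭 i).ΦX U β)) (ev i)
        (familyOp (fun q : P × P => Dd i U q.1 ∘ₗ ((𝔬 i).GG U ∘ₗ Dds i U q.2))))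
    (hRdist : ∀ (i : I) (a a' b : (geo i).Site), Rel i a a' → (geo i).dist a b = (geo i).dist a' b)
    (hmodel : ∀ i, M₁ ≤ (geo i).M → ∀ α₀ : ℝ, 0 < α₀ → (geo i).M * α₀ ≤ a₁ →
      ∀ U : (bg i).Cfg, (bg i).Reg335 c35 α₀ U → (bg i).Reg336 c35 α₀ U →
        Thm33G0 (𝔬 i) (R₀ i) (H₀ i) B₀ δ₀ U ∧
        Step (𝔬 i) (R₀ i) (H₀ i) (hgeo i).lenle 1 (θ₁ * ((geo i).M * α₀)) δK U ∧
        Step (𝔬 i) (R₀ i) (H₀ i) (hgeo i).lenle 2 (θ₁ * ((geo i).M * α₀)) δK U ∧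
        FormSmall (𝔬 i) (r₁ * ((geo i).M * α₀)) U ∧ Identities (𝔬 i) U)
    (hleft : ∀ i, M₁ ≤ (geo i).M → ∀ α₀ : ℝ, 0 < α₀ → (geo i).M * α₀ ≤ a₁ →
      ∀ U : (bg i).Cfg, (bg i).Reg335 c35 α₀ U → (bg i).Reg336 c35 α₀ U →
        LeftStep (𝔬 i) (R₀ i) (H₀ i) (hgeo i).lenle B₀ δ₀ (θD * ((geo i).M * α₀)) δK U)
    (wZ : ∀ i, (geo i).Site → ℝ) (hwZ : ∀ i y, 0 < wZ i y)
    (hletters : ∀ i, M₁ ≤ (geo i).M → ∀ α₀ : ℝ, 0 < α₀ → (geo i).M * α₀ ≤ a₁ →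
      ∀ U : (bg i).Cfg, (bg i).Reg335 c35 α₀ U → (bg i).Reg336 c35 α₀ U →
        Letters313Z (𝔬 i) (R₀ i) (H₀ i) (hgeo i) (wZ i) (hwZ i) B₃ δ₃ U)
    (hlettersD : ∀ i, M₁ ≤ (geo i).M → ∀ α₀ : ℝ, 0 < α₀ → (geo i).M * α₀ ≤ a₁ →
      ∀ U : (bg i).Cfg, (bg i).Reg335 c35 α₀ U → (bg i).Reg336 c35 α₀ U →
        Letters313DZ (𝔬 i) (R₀ i) (H₀ i) (hgeo i) (wZ i) (hwZ i) B₃ δ₃ (bH i) U ∧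
          Letters313DMZ (𝔬 i) (𝔭 i) (Dd i) (R₀ i) (H₀ i) (hgeo i) (wZ i) (hwZ i) B₃ Bq δ₃ (bH i) U)
    (hG0C : ∀ i, M₁ ≤ (geo i).M → ∀ α₀ : ℝ, 0 < α₀ → (geo i).M * α₀ ≤ a₁ →
      ∀ U : (bg i).Cfg, (bg i).Reg335 c35 α₀ U → (bg i).Reg336 c35 α₀ U →
        Thm33G0Dir (𝔬 i) (𝔭 i) (Dd i) (Dds i) (R₀ i) (H₀ i) (bHX i) B₀ Bh Bi Bi2 δ₀ U ∧
          Thm33G0DirR (𝔬 i) (Dds i) (R₀ i) (H₀ i) B₀ δ₀ U)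
    (hstepD : ∀ i, M₁ ≤ (geo i).M → ∀ α₀ : ℝ, 0 < α₀ → (geo i).M * α₀ ≤ a₁ →
      ∀ U : (bg i).Cfg, (bg i).Reg335 c35 α₀ U → (bg i).Reg336 c35 α₀ U →
        StepDirB (𝔬 i) (𝔭 i) (Dd i) (Dds i) (R₀ i) (H₀ i) (bHX i) (hgeo i).lenle (θD * ((geo i).M * α₀))
          (fun β => θH β * ((geo i).M * α₀)) (fun ε => θI ε * ((geo i).M * α₀)) δK U)
    (hLHH : ∀ i, M₁ ≤ (geo i).M → ∀ α₀ : ℝ, 0 < α₀ → (geo i).M * α₀ ≤ a₁ →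
      ∀ U : (bg i).Cfg, (bg i).Reg335 c35 α₀ U → (bg i).Reg336 c35 α₀ U →
        LettersHHZ (𝔬 i) (𝔭 i) (R₀ i) (H₀ i) (hgeo i).lenle
          (weightNorm (BlockNorm.ofBlocks (toB6 (geo i) (R₀ i) (H₀ i)) (𝔬 i).blkZ) (wZ i) fun y => (hwZ i y).le) Bq δ₃ U)
    (hLH3 : ∀ i, M₁ ≤ (geo i).M → ∀ α₀ : ℝ, 0 < α₀ → (geo i).M * α₀ ≤ a₁ →
      ∀ U : (bg i).Cfg, (bg i).Reg335 c35 α₀ U → (bg i).Reg336 c35 α₀ U →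
        Letters313HZ (𝔬 i) (𝔭 i) (R₀ i) (H₀ i) (hgeo i) (wZ i) (hwZ i) (bH i) BhD Bx δ₃ U)
    (hG0L2 : ∀ i, M₁ ≤ (geo i).M → ∀ α₀ : ℝ, 0 < α₀ → (geo i).M * α₀ ≤ a₁ →
      ∀ U : (bg i).Cfg, (bg i).Reg335 c35 α₀ U → (bg i).Reg336 c35 α₀ U →
        Thm33G0L2M (𝔬 i) (Dd i) (Dds i) (R₀ i) (H₀ i) B₂ δ₀ U)
    (hstepL2 : ∀ i, M₁ ≤ (geo i).M → ∀ α₀ : ℝ, 0 < α₀ → (geo i).M * α₀ ≤ a₁ →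
      ∀ U : (bg i).Cfg, (bg i).Reg335 c35 α₀ U → (bg i).Reg336 c35 α₀ U →
        StepL2 (𝔬 i) (R₀ i) (H₀ i) (θ₂ * ((geo i).M * α₀)) δK U)
    (vZ : ∀ i, (geo i).Site → ℝ) (hvZ : ∀ i y, 0 < vZ i y)
    (hLL2 : ∀ i, M₁ ≤ (geo i).M → ∀ α₀ : ℝ, 0 < α₀ → (geo i).M * α₀ ≤ a₁ →
      ∀ U : (bg i).Cfg, (bg i).Reg335 c35 α₀ U → (bg i).Reg336 c35 α₀ U →
        Letters313L2PZ (𝔬 i) (Dd i) (Dds i) (R₀ i) (H₀ i) B₄ δ₃ (vZ i) (hvZ i) U ∧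
          Letters313L2MZ (𝔬 i) (Dd i) (Dds i) (R₀ i) (H₀ i) B₄ δ₃ (vZ i) (hvZ i) U)
    (hLIM : ∀ i, M₁ ≤ (geo i).M → ∀ α₀ : ℝ, 0 < α₀ → (geo i).M * α₀ ≤ a₁ →
      ∀ U : (bg i).Cfg, (bg i).Reg335 c35 α₀ U → (bg i).Reg336 c35 α₀ U →
        Letters313IMB (𝔬 i) (𝔭 i) (Dd i) (Dds i) (R₀ i) (H₀ i) (hgeo i).lenle (bHX i) (bHW i) Br (fun ε => θV ε * ((geo i).M * α₀))
          Bd Bd2 δ₃ δK U) :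
    B9.Thm313Printed c35 geo bg GG (fun i => HasRWExpOfOps (𝔬 i)) (fun i => PosDefKOfOps (𝔬 i)) := by
  -- thresholds and uniform constants
  obtain ⟨MLg, cg, hLg⟩ := hL21 ρ' hρ'
  set M₁' : ℝ := max (max M₁ ML) MLg with hM₁'
  have hM₁'pos : 0 < M₁' := lt_max_of_lt_left (lt_max_of_lt_left hM₁)
  have hle₁ : ∀ {i : I}, M₁' ≤ (geo i).M → M₁ ≤ (geo i).M := fun h => ((le_max_left _ _).trans (le_max_left _ _)).trans h
  have hleL : ∀ {i : I}, M₁' ≤ (geo i).M → ML ≤ (geo i).M := fun h => ((le_max_right _ _).trans (le_max_left _ _)).trans h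
  have hleg : ∀ {i : I}, M₁' ≤ (geo i).M → MLg ≤ (geo i).M := fun h => (le_max_right _ _).trans h
  have hθc : 0 ≤ θ₁ * c := mul_nonneg hθ₁ hc
  have hB₂c : 0 ≤ B₂ * θ₂ * c * c := mul_nonneg (mul_nonneg (mul_nonneg hB₂ hθ₂) hc) hc
  set a₁' : ℝ := min a₁ (min (2 * (θ₁ * c + 1))⁻¹ (2 * (B₂ * θ₂ * c * c + 1))⁻¹) with ha₁'
  have ha₁'pos : 0 < a₁' := lt_min ha₁ (lt_min (inv_pos.mpr (by linarith)) (inv_pos.mpr (by linarith)))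
  have ha₁'le : a₁' ≤ a₁ := min_le_left _ _
  have hLc1 : ∀ i, 1 ≤ Lc := fun i => (hL1 i).trans (hLle i)
  set Λu : ℝ := Lc ^ (4 : ℝ) with hΛu
  set NP : ℝ := Real.sqrt (Fintype.card (P × P)) with hNP
  have hNP0 : 0 ≤ NP := Real.sqrt_nonneg _
  set C₂ : ℝ := const313 (2 * B₀) (2 * B₃) B₃ c with hC₂
  set CD : ℝ := constD313 (B₀ + θD * a₁ * (2 * B₀) * c) (θD * a₁) (2 * B₀) (2 * B₃) B₃ (max κ₀ 0) c with hCD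
  set Csup : ℝ := max C₂ CD with hCsup
  have hC₂0 : 0 ≤ C₂ := const313_nonneg (by linarith) (by linarith) hB₃ hc
  have hCsup0 : 0 ≤ Csup := hC₂0.trans (le_max_left _ _)
  set KpU : ℝ := (B₂ + B₄) + (B₂ + B₄) * (θ₂ * a₁ * (2 * (B₂ + B₄)) * c) * c with hKpU
  have hS0 : 0 ≤ B₂ + B₄ := add_nonneg hB₂ hB₄
  have hKpU0 : 0 ≤ KpU :=
    add_nonneg hS0 (mul_nonneg (mul_nonneg hS0 (mul_nonneg (mul_nonneg (mul_nonneg hθ₂ ha₁.le) (by linarith)) hc)) hc)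
  set KGu : ℝ := constG46 KpU c with hKGu
  have hKGu0 : 0 ≤ KGu := constG46_nonneg hKpU0 hc
  set K6 : ℝ := (Csup + KGu + NP * KGu) * Λu with hK6
  set ρ₄ : ℝ := (1 - α) * ρ' - 3 * σ with hρ₄def
  have hρ₄pos : 0 < ρ₄ := by rw [hρ₄def]; linarith
  have hρ₄r : ρ₄ + 3 * σ ≤ (1 - α) * ρ' := by rw [hρ₄def]; linarith
  have hρ₄1 : ρ₄ ≤ (1 - α) * ρ' := by linarith
  have hρ₄2 : ρ₄ ≤ ρ' := by
    have h1 : (1 - α) * ρ' = ρ' - α * ρ' := by ring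
    rw [hρ₄def, h1]; linarith [mul_nonneg hα0 hρ'.le]
  have hm00 : (0 : ℝ) ≤ m := Nat.cast_nonneg m
  have hmN0 : (0 : ℝ) ≤ mN := Nat.cast_nonneg mN
  set tH : ℝ → ℝ := fun β => θH β * a₁ with htH
  set tD : ℝ := θD * a₁ with htD
  set tI : ℝ → ℝ := fun ε => θI ε * a₁ with htI
  set tV : ℝ → ℝ := fun ε => θV ε * a₁ with htV
  set κu : ℝ := max κ₀ 1 with hκu
  have h1κ : (1 : ℝ) ≤ κu := le_max_right _ _
  set Cu : ℝ → ℝ := fun β => constH313 (Bh β + tH β * (2 * B₀) * c) (tH β) (2 * B₀) (2 * B₃) B₃ (max (BhD β) (Bx β))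
    (max (Bq β) (Bx β))
    κu c with hCu
  set Bβo : ℝ → ℝ := fun β => max ((m : ℝ) * CL * Real.exp (r * ρ₄) * Cu β) 0 with hBβo
  set Bεo : ℝ → ℝ := fun ε => max (Real.exp (r * ρ₄) * ((Bi ε + (B₀ + tD * (2 * B₀) * c) * Λu * tI ε * c) +
    κu * (Bd ε + (B₀ + tD * (2 * B₀) * c) * Λu * tV ε * c) * Br ε * c +
    (B₃ + tD * (2 * B₃) * c) * Λu * (B₃ * (B₃ * (2 * B₀) * c) * c) * c)) 0 with hBεo
  set Bεβo : ℝ → ℝ → ℝ := fun ε β => max (CL * Real.exp (r * ρ₄) *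
    ((Bi2 ε β + (Bh β + max (tH β) (tI (β + ε)) * (2 * B₀) * c) * Λu * max (tH β) (tI (β + ε)) * c) +
    κu * (Bd2 ε β + (Bh β + max (tH β) (tI (β + ε)) * (2 * B₀) * c) * Λu * tV (β + ε) * c) * Br (β + ε) * c +
    (Bq β + max (tH β) (tI (β + ε)) * (2 * B₃) * c) * Λu * (B₃ * (B₃ * (2 * B₀) * c) * c) * c)) 0 with hBεβo
  have hBβo0 : ∀ β, 0 ≤ Bβo β := fun β => le_max_right _ _
  have hBεo0 : ∀ ε, 0 ≤ Bεo ε := fun ε => le_max_right _ _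
  have hBεβo0 : ∀ ε β, 0 ≤ Bεβo ε β := fun ε β => le_max_right _ _
  refine thm313Printed_of_stepRelZ 𝔬 R₀ H₀ GG bH ev evY Rel m θ₁ θD r₁ B₀ δ₀ δK σ c ρ a₁' M₁' ML
    ((mN : ℝ) * m * Cev * CL ^ 2 * Real.exp (r * ρ₄) * K6) ρ₄ B₃ δ₃ ρ' α Lc κ₀ Bβo Bεo Bεβo hθ₁ hθD hr₁ hB₀ hB₃ hσ hρ' hρ'ρ hρS hρ₃ hρδ hc
    ha₁'pos hM₁'pos hρ₄pos hBβo0 hBεo0 hBεβo0 hgeo S hL1 hLle hη hκ hrow hL21 hsat hmult hcoR hco1R hcoG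
    (fun i hM α₀ hα₀ hMa U hU hU' => hmodel i (hle₁ hM) α₀ hα₀ (hMa.trans ha₁'le) U hU hU')
    (fun i hM α₀ hα₀ hMa U hU hU' => hleft i (hle₁ hM) α₀ hα₀ (hMa.trans ha₁'le) U hU hU') wZ hwZ
    (fun i hM α₀ hα₀ hMa U hU hU' => hletters i (hle₁ hM) α₀ hα₀ (hMa.trans ha₁'le) U hU hU')
    (fun i hM α₀ hα₀ hMa U hU hU' => (hlettersD i (hle₁ hM) α₀ hα₀ (hMa.trans ha₁'le) U hU hU').1) ?_
  -- the residual, PROVED per member and per configuration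
  intro i hM α₀ hα₀ hMa U hU hU'
  have hM₁i : M₁ ≤ (geo i).M := hle₁ hM
  have hMpos : 0 < (geo i).M := hM₁.trans_le hM₁i
  have hm0 : 0 ≤ (geo i).M * α₀ := (mul_pos hMpos hα₀).le
  have hma₁ : (geo i).M * α₀ ≤ a₁ := hMa.trans ha₁'le
  have hmθ : (geo i).M * α₀ ≤ (2 * (θ₁ * c + 1))⁻¹ := hMa.trans ((min_le_right _ _).trans (min_le_left _ _))
  have hm₂ : (geo i).M * α₀ ≤ (2 * (B₂ * θ₂ * c * c + 1))⁻¹ := hMa.trans ((min_le_right _ _).trans (min_le_right _ _))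
  obtain ⟨h33, hS1, hS2, -, hI⟩ := hmodel i hM₁i α₀ hα₀ hma₁ U hU hU'
  have hLS := hleft i hM₁i α₀ hα₀ hma₁ U hU hU'
  have hL := hletters i hM₁i α₀ hα₀ hma₁ U hU hU'
  obtain ⟨hLD, hLDM⟩ := hlettersD i hM₁i α₀ hα₀ hma₁ U hU hU'
  obtain ⟨hH0, hHR⟩ := hG0C i hM₁i α₀ hα₀ hma₁ U hU hU'
  have hStD := hstepD i hM₁i α₀ hα₀ hma₁ U hU hU'
  have hHH := hLHH i hM₁i α₀ hα₀ hma₁ U hU hU'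
  have hH3 := hLH3 i hM₁i α₀ hα₀ hma₁ U hU hU'
  have hL2 := hG0L2 i hM₁i α₀ hα₀ hma₁ U hU hU'
  have hStL := hstepL2 i hM₁i α₀ hα₀ hma₁ U hU hU'
  obtain ⟨hLt, hLM⟩ := hLL2 i hM₁i α₀ hα₀ hma₁ U hU hU'
  have hLIi := hLIM i hM₁i α₀ hα₀ hma₁ U hU hU'
  obtain ⟨hsymi, htri⟩ := hsymGG i hM₁i α₀ hα₀ hma₁ U hU hU'
  have hrowi := hrow i (hleL hM)
  obtain ⟨h260, -, hsize⟩ := hLg i (hleg hM)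
  obtain ⟨hl0, hl1, hl2, hl3, hl4, hl5⟩ := hl2N i U
  have hH1 := hH1N i U
  have hIn := hIF i U
  have hlen := (hgeo i).lenle
  -- the second-argument saturation of d from the first-argument one and the symmetry of d
  have hRd₂ : ∀ a b b' : (geo i).Site, Rel i b b' → (geo i).dist a b = (geo i).dist a b' := fun a b b' h => by
    rw [(hgeo i).symm a b, (hgeo i).symm a b', hRdist i b b' a h]
  set θ : ℝ := θ₁ * ((geo i).M * α₀) with hθdef
  set θ' : ℝ := θD * ((geo i).M * α₀) with hθ'def
  set θH' : ℝ → ℝ := fun β => θH β * ((geo i).M * α₀) with hθH'def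
  set θI' : ℝ → ℝ := fun ε => θI ε * ((geo i).M * α₀) with hθI'def
  set θ₂' : ℝ := θ₂ * ((geo i).M * α₀) with hθ₂'def
  set θv' : ℝ → ℝ := fun ε => θV ε * ((geo i).M * α₀) with hθv'def
  have hθ : 0 ≤ θ := mul_nonneg hθ₁ hm0
  have hθ' : 0 ≤ θ' := mul_nonneg hθD hm0
  have hθH' : ∀ β, 0 ≤ β → β < 1 → 0 ≤ θH' β := fun β h0 h1 => mul_nonneg (hθH β h0 h1) hm0
  have hθI' : ∀ ε, 0 < ε → 0 ≤ θI' ε := fun ε hε => mul_nonneg (hθI ε hε) hm0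
  have hθ₂' : 0 ≤ θ₂' := mul_nonneg hθ₂ hm0
  have hθv' : ∀ ε, 0 < ε → 0 ≤ θv' ε := fun ε hε => mul_nonneg (hθV ε hε) hm0
  have hθ'le : θ' ≤ tD := mul_le_mul_of_nonneg_left hma₁ hθD
  have hθH'le : ∀ β, 0 ≤ β → β < 1 → θH' β ≤ tH β := fun β h0 h1 => mul_le_mul_of_nonneg_left hma₁ (hθH β h0 h1)
  have hθI'le : ∀ ε, 0 < ε → θI' ε ≤ tI ε := fun ε hε => mul_le_mul_of_nonneg_left hma₁ (hθI ε hε)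
  have hθ₂'le : θ₂' ≤ θ₂ * a₁ := mul_le_mul_of_nonneg_left hma₁ hθ₂
  have hθv'le : ∀ ε, 0 < ε → θv' ε ≤ tV ε := fun ε hε => mul_le_mul_of_nonneg_left hma₁ (hθV ε hε)
  have hq : θ * c ≤ 1 / 2 := by
    have h := small_aux_mbz hθc hmθ
    calc θ * c = θ₁ * c * ((geo i).M * α₀) := by rw [hθdef]; ring
      _ ≤ 1 / 2 := h
  have hq1 : θ * c < 1 := lt_one_of_le_half hq
  have hq₂ : B₂ * θ₂' * c * c ≤ 1 / 2 := by
    have h := small_aux_mbz hB₂c hm₂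
    calc B₂ * θ₂' * c * c = B₂ * θ₂ * c * c * ((geo i).M * α₀) := by rw [hθ₂'def]; ring
      _ ≤ 1 / 2 := h
  have hq₂1 : B₂ * θ₂' * c * c < 1 := lt_one_of_le_half hq₂
  have hinv0 : 0 ≤ (1 - θ * c)⁻¹ := inv_nonneg.mpr (sub_nonneg.mpr hq1.le)
  have hA₁ : 0 ≤ B₀ * (1 - θ * c)⁻¹ := mul_nonneg hB₀ hinv0
  have hA₃ : 0 ≤ B₃ * (1 - θ * c)⁻¹ := mul_nonneg hB₃ hinv0
  have hA₁le : B₀ * (1 - θ * c)⁻¹ ≤ 2 * B₀ := const_le_two_mul hB₀ hq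
  have hA₃le : B₃ * (1 - θ * c)⁻¹ ≤ 2 * B₃ := const_le_two_mul hB₃ hq
  -- rates
  have hρ'0 : ρ' ≤ δ₀ := by linarith
  have hρ'₃ : ρ' ≤ δ₃ := by linarith
  have hρ'K : ρ' + σ ≤ δK := by linarith
  have hρK : ρ ≤ δK := by linarith
  -- the sup-class constants below Csup
  have hCle : const313 (B₀ * (1 - θ * c)⁻¹) (B₃ * (1 - θ * c)⁻¹) B₃ c ≤ Csup :=
    (const313_mono hA₁ hA₁le hA₃ hA₃le hB₃ hc).trans (le_max_left _ _)
  have hCLle : B₀ + θ' * (B₀ * (1 - θ * c)⁻¹) * c ≤ B₀ + θD * a₁ * (2 * B₀) * c := by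
    have h2 : θ' * (B₀ * (1 - θ * c)⁻¹) ≤ θD * a₁ * (2 * B₀) := mul_le_mul hθ'le hA₁le hA₁ (mul_nonneg hθD ha₁.le)
    have h3 : θ' * (B₀ * (1 - θ * c)⁻¹) * c ≤ θD * a₁ * (2 * B₀) * c := mul_le_mul_of_nonneg_right h2 hc
    linarith
  have hDle : constD313 (B₀ + θ' * (B₀ * (1 - θ * c)⁻¹) * c) θ' (B₀ * (1 - θ * c)⁻¹) (B₃ * (1 - θ * c)⁻¹) B₃ (bH i).κ c ≤
      Csup :=
    (constD313_mono hCLle hθ' hθ'le hA₁ hA₁le hA₃ hA₃le hB₃ ((hκ i).trans (le_max_left _ _)) hc).trans (le_max_right _ _)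
  -- the L²-class constants below KGu and K₆
  have hKp0 : 0 ≤ constKp B₂ B₄ θ₂' c := (constP_nonneg_le hθ₂' hc hq₂1 hS0 hS0 hS0 le_rfl le_rfl le_rfl).1
  have hKGle : constG46 (constKp B₂ B₄ θ₂' c) c ≤ KGu := constG46_mono hKp0 (constKp_le hB₂ hB₄ hθ₂' hθ₂'le hc hq₂) hc
  have hL0i : 0 < (geo i).L := lt_of_lt_of_le one_pos (hL1 i)
  have hL4 : (geo i).L ^ (4 : ℝ) ≤ Λu := Real.rpow_le_rpow hL0i.le (hLle i) (by norm_num)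
  have h1Λu : 1 ≤ Λu := by rw [hΛu]; exact Real.one_le_rpow (hLc1 i) (by norm_num)
  have hΛu0 : 0 ≤ Λu := zero_le_one.trans h1Λu
  have hK60 : 0 ≤ K6 := mul_nonneg (add_nonneg (add_nonneg hCsup0 hKGu0) (mul_nonneg hNP0 hKGu0)) hΛu0
  have hK6a : Csup * Λu ≤ K6 := by
    have h0 : 0 ≤ (KGu + NP * KGu) * Λu := mul_nonneg (add_nonneg hKGu0 (mul_nonneg hNP0 hKGu0)) hΛu0
    calc Csup * Λu ≤ Csup * Λu + (KGu + NP * KGu) * Λu := le_add_of_nonneg_right h0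
      _ = K6 := by rw [hK6]; ring
  have hK6c : NP * (KGu * Λu) ≤ K6 := by
    have h0 : 0 ≤ (Csup + KGu) * Λu := mul_nonneg (add_nonneg hCsup0 hKGu0) hΛu0
    calc NP * (KGu * Λu) ≤ NP * (KGu * Λu) + (Csup + KGu) * Λu := le_add_of_nonneg_right h0
      _ = K6 := by rw [hK6]; ring
  have hK6b : KGu ≤ K6 := by
    have h1 : KGu ≤ KGu * Λu := le_mul_of_one_le_right hKGu0 h1Λu
    have h0 : 0 ≤ (Csup + NP * KGu) * Λu := mul_nonneg (add_nonneg hCsup0 (mul_nonneg hNP0 hKGu0)) hΛu0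
    have h2 : KGu * Λu ≤ K6 :=
      calc KGu * Λu ≤ KGu * Λu + (Csup + NP * KGu) * Λu := le_add_of_nonneg_right h0
        _ = K6 := by rw [hK6]; ring
    exact h1.trans h2
  -- the scale transfers of p. 398 at (ρ′, α) and the uniform bound of their constants
  have hST : ∀ γ : ℝ, |γ| ≤ 4 → ScaleTransfer (geo i) ρ' α ((geo i).L ^ |γ|) (fun y => (geo i).len y ^ γ) ∧
      0 ≤ (geo i).L ^ |γ| ∧ (geo i).L ^ |γ| ≤ Λu := fun γ hγ =>
    ⟨scaleTransfer_rpow_of_260 h260 hsize (hL1 i) (hη i) γ hγ, Real.rpow_nonneg hL0i.le _,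
      (B9Ineq347AllEntries.size_condition_compact (geo i).L γ _ (hL1 i) hγ hsize).2.trans hL4⟩
  obtain ⟨hST1, hΛ₁0, hΛ₁le⟩ := hST 1 (by norm_num)
  obtain ⟨hSTh, -, hΛhle⟩ := hST (1 / 2) (by rw [abs_of_nonneg (by norm_num : (0 : ℝ) ≤ 1 / 2)]; norm_num)
  obtain ⟨hSTm, hΛm0, hΛmle⟩ := hST (-1) (by norm_num)
  -- the L² schemas at the common rate ρ
  have hexpK : ∀ y y' : (geo i).Site, Real.exp (-(δK * (geo i).dist y y')) ≤ Real.exp (-(ρ * (geo i).dist y y')) := fun y y' =>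
    Real.exp_le_exp.mpr (neg_le_neg (mul_le_mul_of_nonneg_right hρK ((hgeo i).dnn y y')))
  have hL2ρ : Thm33G0L2M (𝔬 i) (Dd i) (Dds i) (R₀ i) (H₀ i) B₂ ρ U := thm33G0L2M_mono (hgeo i) hB₂ hρS hL2
  have hTρ : BlockBd (g := toB6 (geo i) (R₀ i) (H₀ i)) (𝔬 i).blk (𝔬 i).blk ((𝔬 i).Tpi U + (𝔬 i).T2 U)
      (fun (y y' : (geo i).Site) => θ₂' * ((geo i).len y)⁻¹ * ((geo i).len y')⁻¹ * Real.exp (-(ρ * (geo i).dist y y'))) :=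
    hStL.t1.mono fun y y' => mul_le_mul_of_nonneg_left (hexpK y y')
      (mul_nonneg (mul_nonneg hθ₂' (inv_nonneg.mpr (hlen y))) (inv_nonneg.mpr (hlen y')))
  have hLtρ : Letters313L2PZ (𝔬 i) (Dd i) (Dds i) (R₀ i) (H₀ i) B₄ ρ (vZ i) (hvZ i) U := letters313L2PZ_mono (hgeo i) hB₄ hρ₃ hLt
  have hLMρ : Letters313L2MZ (𝔬 i) (Dd i) (Dds i) (R₀ i) (H₀ i) B₄ ρ (vZ i) (hvZ i) U := letters313L2MZ_mono (hgeo i) hB₄ hρ₃ hLM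
  -- the L² block of 𝔊, proved (the mixed member on the pair family)
  have hl2B := GG_l2Block_pairMZ (hgeo i) (Rel i) (ev i) (evY i) hrowi hc hθ hθ' hθ₂' hB₀ hB₂ hB₃ hB₄ hσ hρ' hρ'ρ hρ'ρ₅ hρS hρ₃ hρδ
    hq1 hq₂1 hρ₄pos.le hρ₄1 hρ₄2 hST1 hSTh hSTm hΛ₁0 hΛ₁le hΛhle hΛm0 hΛmle h1Λu hCsup0 hCle hDle hKGu0 hKGle hK60 hK6a hK6b hK6c
    hS1.step1 hS2.step1 h33.e0 h33.e2 hLS hL hLD hI hL2ρ hTρ hLtρ hLMρ hsymi htri hRd₂ (hmult i) (hnbr i) hCL1 (hCL i) hCev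
    hl0 hl1 hl2 hl3 hl4 hl5
  -- the Hölder block of 𝔊, proved
  have hκi : (bH i).κ ≤ κu := (hκ i).trans (le_max_left _ _)
  have hκWi : ∀ ε, (bHW i ε).κ ≤ κu := fun ε => (hκW i ε).trans (le_max_left _ _)
  have hHo := GG_holder_pairMBZ (hgeo i) (𝔭 i) (GG i) (Rel i) hrowi hc hθ hθ' hθH' hθI' hθv' hθ'le hθH'le hθI'le hθv'le hB₀ hB₃ hBr
    hq hBh hBi hBq
    hBd hBi2 hBd2 hBhD hBx hΛ₁0 hΛ₁le hκi hκWi h1κ hα0 hσ hρ' hρ'ρ hρ₄pos.le hρ₄r hρS hρ₃ hρδ hρ'0 hρ'₃ hρ'K hST1 h33.e0 h33.e2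
    hS1.step1 hS2.step1 hH0 hHR hStD hHH hH3 hL hLD hLDM hLIi hI hRd₂ (hmult i) hCL1 (hCL i) hH1 hIn
  have hβo : ∀ β, 0 ≤ β → β < 1 → (m : ℝ) * CL * Real.exp (r * ρ₄) * Cu β ≤ Bβo β ∧ 0 ≤ Bβo β := fun β _ _ =>
    ⟨le_max_left _ _, hBβo0 β⟩
  have hεo : ∀ ε, 0 < ε → ε ≤ 1 →
      Real.exp (r * ρ₄) * ((Bi ε + (B₀ + tD * (2 * B₀) * c) * Λu * tI ε * c) +
        κu * (Bd ε + (B₀ + tD * (2 * B₀) * c) * Λu * tV ε * c) * Br ε * c +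
        (B₃ + tD * (2 * B₃) * c) * Λu * (B₃ * (B₃ * (2 * B₀) * c) * c) * c) ≤ Bεo ε ∧ 0 ≤ Bεo ε := fun ε _ _ =>
    ⟨le_max_left _ _, hBεo0 ε⟩
  have hεβo : ∀ ε β, 0 < ε → ε ≤ 1 → 0 ≤ β → β < 1 →
      CL * Real.exp (r * ρ₄) *
        ((Bi2 ε β + (Bh β + max (tH β) (tI (β + ε)) * (2 * B₀) * c) * Λu * max (tH β) (tI (β + ε)) * c) +
        κu * (Bd2 ε β + (Bh β + max (tH β) (tI (β + ε)) * (2 * B₀) * c) * Λu * tV (β + ε) * c) * Br (β + ε) * c +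
        (Bq β + max (tH β) (tI (β + ε)) * (2 * B₃) * c) * Λu * (B₃ * (B₃ * (2 * B₀) * c) * c) * c) ≤ Bεβo ε β ∧ 0 ≤ Bεβo ε β :=
      fun ε β _ _ _ _ =>
    ⟨le_max_left _ _, hBεβo0 ε β⟩
  exact ⟨hl2B, ineq343_345_mono_on (S i) hHo (hgeo i).lenpos hβo hεo hεβo le_rfl⟩

end Family

end

end Literature.MathematicalPhysics.QuantumFieldTheory.Balaban1983to89.B9Thm313WholeLeafCompletePairMBZ
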